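import Literature.Computability.Complexity.SymbolPrograms
import HarnessLib

/-!
# While-loops, unary blocks and paid lockstep loops for binary stack programs

Literature / complexity toolkit: a small library of generic routines for the structured binary
stack programs `ACom Bool ι` of `SymbolPrograms.lean` (registers `ι`), with exact effects and
step counts, used by the transcript checker and the diagonalizer of the nondeterministic time
hierarchy theorem (`FlatTranscripts.lean`, `NTIMEHierarchyDiagonal.lean`). The one control
structure of `ACom` is `loop k f` ("while register `k` is nonempty, pop it and run `f`"); a
general while-loop is `loop w body` on a *token register* `w` which the body refills to
continue (`SymbolPrograms.lean`, docstring of `ACom.loop`). On top of it: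

* `StackWhile.readBlock src dst w` — read a unary block `1ᵃ 0` from `src`, adding `1ᵃ` to `dst`
  (`6a + 6` steps, also on an unterminated block `1ᵃ`);
* `StackWhile.moveBlock src dst cnt w` — move a block symbol by symbol onto `dst` (reversed,
  terminator included), counting its tokens on `cnt`;
* `StackWhile.payLock y y2 tr flag w` — the PAID lockstep: pop one symbol of `tr` per token of
  the yardstick `y` (tokens parked on `y2`, poured back by the caller), raising `flag` if `tr`
  runs out first; the cost is proportional to the symbols consumed, not to `|y|` — the device
  by which a transcript pays for the checker's work in advance;
* `StackWhile.cmpUnary a b b2 ne` — compare the unary counter `a` (consumed) with `b` (tokens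
  parked on `b2`), raising `ne` iff they differ;

Effects are stated in *frame style*: the final store is described register by register, all
unnamed registers being unchanged, for an arbitrary store with the named registers pairwise
distinct — so that the lemmas instantiate in any register file.

## References

* T. Nipkow, G. Klein, *Concrete Semantics with Isabelle/HOL*, Springer 2014, §7.2 (while
  loops, big-step reasoning).
* M. L. Minsky, *Computation: Finite and Infinite Machines*, Prentice-Hall 1967, §11.1, §14.1.
-/

namespace Literature.Computability.Complexity

open Function

namespace StackWhile

open ACom

variable {ι : Type} [DecidableEq ι]

/-- Unary words. [folklore] -/
abbrev un (n : ℕ) : List Bool := List.replicate n true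

/-- A block tail: empty (unterminated block) or starting with the terminator `0`. [folklore] -/
def IsTail (t : List Bool) : Prop := t = [] ∨ ∃ r, t = false :: r

/-- Every word is `1ᵃ` followed by a block tail (`a` = number of leading `1`s). [folklore] -/
theorem exists_un_append_isTail : ∀ l : List Bool, ∃ (a : ℕ) (t : List Bool), IsTail t ∧ l = un a ++ t
  | [] => ⟨0, [], Or.inl rfl, rfl⟩
  | false :: r => ⟨0, false :: r, Or.inr ⟨r, rfl⟩, rfl⟩
  | true :: r => by
    obtain ⟨a, t, ht, rfl⟩ := exists_un_append_isTail r
    exact ⟨a + 1, t, ht, rfl⟩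

/-- A block tail starts with no `1`. [folklore] -/
theorem IsTail.eq_cons {t : List Bool} (ht : IsTail t) {b : Bool} {r : List Bool}
    (h : t = b :: r) : b = false := by
  rcases ht with rfl | ⟨r', rfl⟩
  · cases h
  · cases h; rfl

/-! ### Reading a unary block -/

/-- The body of `readBlock`: on `1` add a token to `dst` and continue. [folklore] -/
def readBody (dst w : ι) : Option Bool → ACom Bool ι
  | some true => push dst true ;; push w true
  | _ => skip

/-- `readBlock src dst w`: read a unary block `1ᵃ 0` from `src` (consuming its terminator if
present), adding `1ᵃ` on top of `dst`; `w` is the token register of the while-loop (empty before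
and after). [folklore] -/
def readBlock (src dst w : ι) : ACom Bool ι :=
  push w true ;; loop w fun _ => pop src (readBody dst w)

/-- The loop of `readBlock`, from a store holding one loop token. [folklore] -/
theorem runs_readLoop {src dst w : ι} (hsw : src ≠ w) (hdw : dst ≠ w) (hsd : src ≠ dst) :
    ∀ (a : ℕ) {t : List Bool} (_ : IsTail t) (R : AStore Bool ι),
      R src = un a ++ t → R w = [true] → ∃ R' : AStore Bool ι,
        Runs (loop w fun _ => pop src (readBody dst w)) R R' (6 * a + 5) ∧
        R' src = t.tail ∧ R' dst = un a ++ R dst ∧ R' w = [] ∧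
        ∀ r, r ≠ src → r ≠ dst → r ≠ w → R' r = R r
  | 0, t, ht, R, hs, hw => by
    rcases ht with rfl | ⟨r, rfl⟩
    · refine ⟨update R w [], ?_, by simp [update_of_ne hsw, hs], by simp [update_of_ne hdw],
        by simp, fun r _ _ h3 => by simp [update_of_ne h3]⟩
      have hbody : Runs (pop src (readBody dst w)) (update R w []) (update R w []) 2 :=
        Runs.pop_nil (by rw [update_of_ne hsw]; simpa using hs) (Runs.skip _)
      exact (Runs.loop_cons (k := w) (f := fun _ => pop src (readBody dst w)) (a := true)
        (w := []) hw hbody (Runs.loop_nil _ (by simp))).mono (by omega)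
    · refine ⟨update (update R w []) src r, ?_, by simp, by simp [update_of_ne hdw, update_of_ne hsd.symm],
        by simp [update_of_ne hsw.symm], fun r' h1 _ h3 => by simp [update_of_ne h1, update_of_ne h3]⟩
      have hbody : Runs (pop src (readBody dst w)) (update R w [])
          (update (update R w []) src r) 2 :=
        Runs.pop_cons (f := readBody dst w) (a := false) (w := r)
          (by rw [update_of_ne hsw]; simpa using hs) (Runs.skip _)
      exact (Runs.loop_cons (k := w) (f := fun _ => pop src (readBody dst w)) (a := true)
        (w := []) hw hbody (Runs.loop_nil _ (by simp [update_of_ne hsw.symm]))).mono (by omega)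
  | a + 1, t, ht, R, hs, hw => by
    -- pop a `1`: push a token on `dst`, refill `w`
    set R₁ : AStore Bool ι :=
      update (update (update (update R w []) src (un a ++ t)) dst (true :: R dst)) w [true] with hR₁
    have hbody : Runs (pop src (readBody dst w)) (update R w []) R₁ (2 + 2) := by
      refine Runs.pop_cons (f := readBody dst w) (a := true) (w := un a ++ t)
        (by rw [update_of_ne hsw]; simpa [un, List.replicate_succ] using hs) ?_
      refine ((Runs.push dst true _).seq (Runs.push' ?_)).of_eq rfl (by norm_num)
      rw [hR₁]
      simp [update_of_ne hsd.symm, update_of_ne hdw, update_of_ne hdw.symm, update_of_ne hsw.symm]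
    obtain ⟨R', hR', h1, h2, h3, h4⟩ := runs_readLoop hsw hdw hsd a ht R₁
      (by simp [hR₁, update_of_ne hsw, update_of_ne hsd]) (by simp [hR₁])
    refine ⟨R', ?_, h1, ?_, h3, fun r g1 g2 g3 => ?_⟩
    · exact (Runs.loop_cons (k := w) (f := fun _ => pop src (readBody dst w)) (a := true)
        (w := []) hw hbody hR').mono (by omega)
    · rw [h2, hR₁]; simp [update_of_ne hdw, un, List.replicate_succ']
    · rw [h4 r g1 g2 g3, hR₁]; simp [update_of_ne g1, update_of_ne g2, update_of_ne g3]

/-- **Effect and cost of `readBlock`**: if `src = 1ᵃ ++ t` with `t` a block tail and the token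
register is empty, then afterwards `src = t.tail` (terminator consumed), `dst = 1ᵃ ++ dst`, `w`
empty, everything else unchanged, within `6a + 6` steps. [folklore] -/
theorem runs_readBlock {src dst w : ι} (hsw : src ≠ w) (hdw : dst ≠ w) (hsd : src ≠ dst)
    {a : ℕ} {t : List Bool} (ht : IsTail t) (R : AStore Bool ι) (hs : R src = un a ++ t)
    (hw : R w = []) : ∃ R' : AStore Bool ι,
      Runs (readBlock src dst w) R R' (6 * a + 6) ∧
      R' src = t.tail ∧ R' dst = un a ++ R dst ∧ R' w = [] ∧
      ∀ r, r ≠ src → r ≠ dst → r ≠ w → R' r = R r := by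
  obtain ⟨R', hR', h1, h2, h3, h4⟩ := runs_readLoop hsw hdw hsd a ht (update R w [true])
    (by rw [update_of_ne hsw]; exact hs) (by simp)
  refine ⟨R', ?_, h1, by rw [h2, update_of_ne hdw], h3, fun r g1 g2 g3 => by
    rw [h4 r g1 g2 g3, update_of_ne g3]⟩
  have h0 : Runs (push w true) R (update R w [true]) 1 := Runs.push' (by rw [hw])
  exact (h0.seq hR').mono (by omega)

/-! ### Moving a block, counting its tokens -/

/-- The body of `moveBlock`: on `1` move it to `dst`, count it on `cnt`, continue; on `0` move
it and stop. [folklore] -/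
def moveBody (dst cnt w : ι) : Option Bool → ACom Bool ι
  | some true => push dst true ;; push cnt true ;; push w true
  | some false => push dst false
  | none => skip

/-- `moveBlock src dst cnt w`: move a unary block `1ᵃ 0` from `src` onto `dst` symbol by symbol
(so `dst` receives it reversed, terminator on top) while counting `1ᵃ` on `cnt`. [folklore] -/
def moveBlock (src dst cnt w : ι) : ACom Bool ι :=
  push w true ;; loop w fun _ => pop src (moveBody dst cnt w)

/-- The loop of `moveBlock`, from a store holding one loop token. [folklore] -/
theorem runs_moveLoop {src dst cnt w : ι} (hsw : src ≠ w) (hdw : dst ≠ w) (hcw : cnt ≠ w)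
    (hsd : src ≠ dst) (hsc : src ≠ cnt) (hdc : dst ≠ cnt) :
    ∀ (a : ℕ) {t : List Bool} (_ : IsTail t) (R : AStore Bool ι),
      R src = un a ++ t → R w = [true] → ∃ R' : AStore Bool ι,
        Runs (loop w fun _ => pop src (moveBody dst cnt w)) R R' (7 * a + 6) ∧
        R' src = t.tail ∧ R' dst = t.take 1 ++ un a ++ R dst ∧ R' cnt = un a ++ R cnt ∧
        R' w = [] ∧ ∀ r, r ≠ src → r ≠ dst → r ≠ cnt → r ≠ w → R' r = R r
  | 0, t, ht, R, hs, hw => by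
    rcases ht with rfl | ⟨r, rfl⟩
    · refine ⟨update R w [], ?_, by simp [update_of_ne hsw, hs], by simp [update_of_ne hdw],
        by simp [update_of_ne hcw], by simp, fun r _ _ _ h4 => by simp [update_of_ne h4]⟩
      have hbody : Runs (pop src (moveBody dst cnt w)) (update R w []) (update R w []) 2 :=
        Runs.pop_nil (by rw [update_of_ne hsw]; simpa using hs) (Runs.skip _)
      exact (Runs.loop_cons (k := w) (f := fun _ => pop src (moveBody dst cnt w)) (a := true)
        (w := []) hw hbody (Runs.loop_nil _ (by simp))).mono (by omega)
    · refine ⟨update (update (update R w []) src r) dst (false :: R dst), ?_,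
        by simp [update_of_ne hsd], by simp,
        by simp [update_of_ne hdc.symm, update_of_ne hsc.symm, update_of_ne hcw],
        by simp [update_of_ne hdw.symm, update_of_ne hsw.symm],
        fun r' h1 h2 _ h4 => by simp [update_of_ne h1, update_of_ne h2, update_of_ne h4]⟩
      have hbody : Runs (pop src (moveBody dst cnt w)) (update R w [])
          (update (update (update R w []) src r) dst (false :: R dst)) (1 + 2) :=
        Runs.pop_cons (f := moveBody dst cnt w) (a := false) (w := r)
          (by rw [update_of_ne hsw]; simpa using hs)
          (Runs.push' (by simp [update_of_ne hsd.symm, update_of_ne hdw]))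
      exact (Runs.loop_cons (k := w) (f := fun _ => pop src (moveBody dst cnt w)) (a := true)
        (w := []) hw hbody (Runs.loop_nil _
          (by simp [update_of_ne hdw.symm, update_of_ne hsw.symm]))).mono (by omega)
  | a + 1, t, ht, R, hs, hw => by
    set R₁ : AStore Bool ι :=
      update (update (update (update (update R w []) src (un a ++ t)) dst (true :: R dst)) cnt
        (true :: R cnt)) w [true] with hR₁
    have hbody : Runs (pop src (moveBody dst cnt w)) (update R w []) R₁ (3 + 2) := by
      refine Runs.pop_cons (f := moveBody dst cnt w) (a := true) (w := un a ++ t)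
        (by rw [update_of_ne hsw]; simpa [un, List.replicate_succ] using hs) ?_
      have e3 : Runs (push dst true ;; push cnt true ;; push w true)
          (update (update R w []) src (un a ++ t)) R₁ (1 + (1 + 1)) := by
        refine (Runs.push dst true _).seq ((Runs.push cnt true _).seq (Runs.push' ?_))
        rw [hR₁]
        simp [update_of_ne hsd.symm, update_of_ne hdw, update_of_ne hdw.symm, update_of_ne hcw,
          update_of_ne hcw.symm, update_of_ne hdc.symm, update_of_ne hsc.symm, update_of_ne hsw.symm]
      exact e3
    obtain ⟨R', hR', h1, h2, h3, h4, h5⟩ := runs_moveLoop hsw hdw hcw hsd hsc hdc a ht R₁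
      (by simp [hR₁, update_of_ne hsw, update_of_ne hsd, update_of_ne hsc]) (by simp [hR₁])
    refine ⟨R', ?_, h1, ?_, ?_, h4, fun r g1 g2 g3 g4 => ?_⟩
    · exact (Runs.loop_cons (k := w) (f := fun _ => pop src (moveBody dst cnt w)) (a := true)
        (w := []) hw hbody hR').mono (by omega)
    · rw [h2, hR₁]
      simp [update_of_ne hdw, update_of_ne hdc, un, List.replicate_succ']
    · rw [h3, hR₁]; simp [update_of_ne hcw, un, List.replicate_succ']
    · rw [h5 r g1 g2 g3 g4, hR₁]
      simp [update_of_ne g1, update_of_ne g2, update_of_ne g3, update_of_ne g4]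

/-- **Effect and cost of `moveBlock`**: if `src = 1ᵃ ++ t` (`t` a block tail) and `w` is empty,
then afterwards `src = t.tail`, `dst = t.take 1 ++ 1ᵃ ++ dst` (the block reversed on top of
`dst`), `cnt = 1ᵃ ++ cnt`, `w` empty, everything else unchanged, within `7a + 7` steps.
[folklore] -/
theorem runs_moveBlock {src dst cnt w : ι} (hsw : src ≠ w) (hdw : dst ≠ w) (hcw : cnt ≠ w)
    (hsd : src ≠ dst) (hsc : src ≠ cnt) (hdc : dst ≠ cnt)
    {a : ℕ} {t : List Bool} (ht : IsTail t) (R : AStore Bool ι) (hs : R src = un a ++ t)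
    (hw : R w = []) : ∃ R' : AStore Bool ι,
      Runs (moveBlock src dst cnt w) R R' (7 * a + 7) ∧
      R' src = t.tail ∧ R' dst = t.take 1 ++ un a ++ R dst ∧ R' cnt = un a ++ R cnt ∧
      R' w = [] ∧ ∀ r, r ≠ src → r ≠ dst → r ≠ cnt → r ≠ w → R' r = R r := by
  obtain ⟨R', hR', h1, h2, h3, h4, h5⟩ := runs_moveLoop hsw hdw hcw hsd hsc hdc a ht
    (update R w [true]) (by rw [update_of_ne hsw]; exact hs) (by simp)
  refine ⟨R', ?_, h1, by rw [h2, update_of_ne hdw], by rw [h3, update_of_ne hcw], h4,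
    fun r g1 g2 g3 g4 => by rw [h5 r g1 g2 g3 g4, update_of_ne g4]⟩
  have h0 : Runs (push w true) R (update R w [true]) 1 := Runs.push' (by rw [hw])
  exact (h0.seq hR').mono (by omega)

/-! ### Paid lockstep -/

/-- The body of `payLock`: take a token of the yardstick `y` (park it on `y2`); then one symbol
of `tr` must pay for it (continue), else raise `flag` and stop; stop quietly when `y` is
exhausted. [folklore] -/
def payBody (y y2 tr flag w : ι) : ACom Bool ι :=
  pop y fun o => match o with
    | none => skip
    | some _ => push y2 true ;; pop tr fun o' => match o' with
      | none => push flag true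
      | some _ => push w true

/-- `payLock y y2 tr flag w`: consume one symbol of `tr` per token of `y` (which is moved to
`y2`; the caller pours it back), raising `flag` if `tr` runs out first. [folklore] -/
def payLock (y y2 tr flag w : ι) : ACom Bool ι :=
  push w true ;; loop w fun _ => payBody y y2 tr flag w

/-- The loop of `payLock` when the payment suffices: `y = 1ⁿ`, `|tr| ≥ n`. [folklore] -/
theorem runs_payLoop_ok {y y2 tr flag w : ι} (hyw : y ≠ w) (h2w : y2 ≠ w) (htw : tr ≠ w)
    (hy2 : y ≠ y2) (hyt : y ≠ tr) (h2t : y2 ≠ tr) :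
    ∀ (n : ℕ) (R : AStore Bool ι), R y = un n → n ≤ (R tr).length → R w = [true] →
      ∃ R' : AStore Bool ι, Runs (loop w fun _ => payBody y y2 tr flag w) R R' (8 * n + 5) ∧
        R' y = [] ∧ R' y2 = un n ++ R y2 ∧ R' tr = (R tr).drop n ∧ R' w = [] ∧
        ∀ r, r ≠ y → r ≠ y2 → r ≠ tr → r ≠ w → R' r = R r
  | 0, R, hy, _, hw => by
    refine ⟨update R w [], ?_, by simp [update_of_ne hyw, hy], by simp [update_of_ne h2w],
      by simp [update_of_ne htw], by simp, fun r _ _ _ h4 => by simp [update_of_ne h4]⟩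
    have hbody : Runs (payBody y y2 tr flag w) (update R w []) (update R w []) 2 :=
      Runs.pop_nil (by rw [update_of_ne hyw]; simpa using hy) (Runs.skip _)
    exact (Runs.loop_cons (k := w) (f := fun _ => payBody y y2 tr flag w) (a := true) (w := [])
      hw hbody (Runs.loop_nil _ (by simp))).mono (by omega)
  | n + 1, R, hy, hn, hw => by
    obtain ⟨b, rest, htr⟩ : ∃ b rest, R tr = b :: rest := by
      cases h : R tr with
      | nil => rw [h] at hn; simp at hn
      | cons b rest => exact ⟨b, rest, rfl⟩
    set R₁ : AStore Bool ι :=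
      update (update (update (update (update R w []) y (un n)) y2 (true :: R y2)) tr rest) w [true]
      with hR₁
    have hbody : Runs (payBody y y2 tr flag w) (update R w []) R₁ ((1 + (1 + 2)) + 2) := by
      refine Runs.pop_cons (f := fun o => match o with
        | none => skip
        | some _ => push y2 true ;; pop tr fun o' => match o' with
          | none => push flag true
          | some _ => push w true) (a := true) (w := un n)
        (by rw [update_of_ne hyw]; simpa [un, List.replicate_succ] using hy) ?_
      refine (Runs.push y2 true _).seq ?_
      refine Runs.pop_cons (f := fun o' => match o' with
          | none => push flag true
          | some _ => push w true) (a := b) (w := rest)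
        (by simp [update_of_ne h2t.symm, update_of_ne hyt.symm, update_of_ne htw, htr]) ?_
      refine Runs.push' ?_
      rw [hR₁]
      simp [update_of_ne h2w.symm, update_of_ne hyw.symm, update_of_ne htw.symm,
        update_of_ne hy2.symm, update_of_ne h2w]
    obtain ⟨R', hR', h1, h2, h3, h4, h5⟩ := runs_payLoop_ok hyw h2w htw hy2 hyt h2t n R₁
      (by simp [hR₁, update_of_ne hyw, update_of_ne hy2, update_of_ne hyt])
      (by simp [hR₁, update_of_ne htw]; rw [htr] at hn; simpa using hn) (by simp [hR₁])
    refine ⟨R', ?_, h1, ?_, ?_, h4, fun r g1 g2 g3 g4 => ?_⟩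
    · exact (Runs.loop_cons (k := w) (f := fun _ => payBody y y2 tr flag w) (a := true) (w := [])
        hw hbody hR').mono (by omega)
    · rw [h2, hR₁]; simp [update_of_ne h2w, update_of_ne h2t, un, List.replicate_succ']
    · rw [h3, hR₁, htr]; simp [update_of_ne htw]
    · rw [h5 r g1 g2 g3 g4, hR₁]
      simp [update_of_ne g1, update_of_ne g2, update_of_ne g3, update_of_ne g4]

/-- The loop of `payLock` when the payment runs out: `y = 1ⁿ`, `|tr| < n`: after `|tr| + 1`
rounds `flag` is raised. [folklore] -/
theorem runs_payLoop_short {y y2 tr flag w : ι} (hyw : y ≠ w) (h2w : y2 ≠ w) (htw : tr ≠ w)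
    (hfw : flag ≠ w) (hy2 : y ≠ y2) (hyt : y ≠ tr) (hyf : y ≠ flag) (h2t : y2 ≠ tr)
    (h2f : y2 ≠ flag) (htf : tr ≠ flag) :
    ∀ (m n : ℕ) (R : AStore Bool ι), R y = un n → (R tr).length = m → m < n → R w = [true] →
      ∃ R' : AStore Bool ι, Runs (loop w fun _ => payBody y y2 tr flag w) R R' (8 * m + 9) ∧
        R' y = un (n - m - 1) ∧ R' y2 = un (m + 1) ++ R y2 ∧ R' tr = [] ∧ R' w = [] ∧
        R' flag = true :: R flag ∧
        ∀ r, r ≠ y → r ≠ y2 → r ≠ tr → r ≠ w → r ≠ flag → R' r = R r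
  | 0, n, R, hy, hm, hmn, hw => by
    obtain ⟨n, rfl⟩ : ∃ n', n = n' + 1 := ⟨n - 1, by omega⟩
    have htr : R tr = [] := List.length_eq_zero_iff.1 hm
    set R' : AStore Bool ι :=
      update (update (update (update R w []) y (un n)) y2 (true :: R y2)) flag (true :: R flag)
      with hR'
    refine ⟨R', ?_, by simp [hR', update_of_ne hyf, update_of_ne hy2],
      by simp [hR', update_of_ne h2f, un], by simp [hR', update_of_ne htf, update_of_ne h2t.symm,
        update_of_ne hyt.symm, update_of_ne htw, htr],
      by simp [hR', update_of_ne hfw.symm, update_of_ne h2w.symm, update_of_ne hyw.symm],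
      by simp [hR'], fun r g1 g2 _ g4 g5 => by
        simp [hR', update_of_ne g1, update_of_ne g2, update_of_ne g4, update_of_ne g5]⟩
    have hbody : Runs (payBody y y2 tr flag w) (update R w []) R' ((1 + (1 + 2)) + 2) := by
      refine Runs.pop_cons (f := fun o => match o with
        | none => skip
        | some _ => push y2 true ;; pop tr fun o' => match o' with
          | none => push flag true
          | some _ => push w true) (a := true) (w := un n)
        (by rw [update_of_ne hyw]; simpa [un, List.replicate_succ] using hy) ?_
      refine (Runs.push y2 true _).seq ?_
      refine Runs.pop_nil
        (by simp [update_of_ne h2t.symm, update_of_ne hyt.symm, update_of_ne htw, htr]) ?_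
      refine Runs.push' ?_
      rw [hR']
      simp [update_of_ne h2f.symm, update_of_ne hyf.symm, update_of_ne hfw, update_of_ne hy2.symm,
        update_of_ne h2w]
    exact (Runs.loop_cons (k := w) (f := fun _ => payBody y y2 tr flag w) (a := true) (w := [])
      hw hbody (Runs.loop_nil _ (by simp [hR', update_of_ne hfw.symm, update_of_ne h2w.symm,
        update_of_ne hyw.symm]))).mono (by omega)
  | m + 1, n, R, hy, hm, hmn, hw => by
    obtain ⟨n, rfl⟩ : ∃ n', n = n' + 1 := ⟨n - 1, by omega⟩
    obtain ⟨b, rest, htr⟩ : ∃ b rest, R tr = b :: rest := by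
      cases h : R tr with
      | nil => rw [h] at hm; simp at hm
      | cons b rest => exact ⟨b, rest, rfl⟩
    have hrest : rest.length = m := by rw [htr] at hm; simpa using hm
    set R₁ : AStore Bool ι :=
      update (update (update (update (update R w []) y (un n)) y2 (true :: R y2)) tr rest) w [true]
      with hR₁
    have hbody : Runs (payBody y y2 tr flag w) (update R w []) R₁ ((1 + (1 + 2)) + 2) := by
      refine Runs.pop_cons (f := fun o => match o with
        | none => skip
        | some _ => push y2 true ;; pop tr fun o' => match o' with
          | none => push flag true
          | some _ => push w true) (a := true) (w := un n)
        (by rw [update_of_ne hyw]; simpa [un, List.replicate_succ] using hy) ?_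
      refine (Runs.push y2 true _).seq ?_
      refine Runs.pop_cons (f := fun o' => match o' with
          | none => push flag true
          | some _ => push w true) (a := b) (w := rest)
        (by simp [update_of_ne h2t.symm, update_of_ne hyt.symm, update_of_ne htw, htr]) ?_
      refine Runs.push' ?_
      rw [hR₁]
      simp [update_of_ne h2w.symm, update_of_ne hyw.symm, update_of_ne htw.symm,
        update_of_ne hy2.symm, update_of_ne h2w]
    obtain ⟨R', hR', h1, h2, h3, h4, h5, h6⟩ := runs_payLoop_short hyw h2w htw hfw hy2 hyt hyf
      h2t h2f htf m n R₁
      (by simp [hR₁, update_of_ne hyw, update_of_ne hy2, update_of_ne hyt])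
      (by simp [hR₁, update_of_ne htw, hrest]) (by omega) (by simp [hR₁])
    refine ⟨R', ?_, ?_, ?_, h3, h4, ?_, fun r g1 g2 g3 g4 g5 => ?_⟩
    · exact (Runs.loop_cons (k := w) (f := fun _ => payBody y y2 tr flag w) (a := true) (w := [])
        hw hbody hR').mono (by omega)
    · rw [h1]; congr 1; omega
    · rw [h2, hR₁]; simp [update_of_ne h2w, update_of_ne h2t, un, List.replicate_succ']
    · rw [h5, hR₁]
      simp only [update_of_ne hfw, update_of_ne htf.symm, update_of_ne h2f.symm,
        update_of_ne hyf.symm]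
    · rw [h6 r g1 g2 g3 g4 g5, hR₁]
      simp [update_of_ne g1, update_of_ne g2, update_of_ne g3, update_of_ne g4]

/-- **`payLock`, payment sufficient**: with `y = 1ⁿ`, `|tr| ≥ n` and `w` empty: afterwards `y` is
empty, `y2 = 1ⁿ ++ y2`, `tr` lost its first `n` symbols, `flag` untouched, within `8n + 6`
steps. [folklore] -/
theorem runs_payLock_ok {y y2 tr flag w : ι} (hyw : y ≠ w) (h2w : y2 ≠ w) (htw : tr ≠ w)
    (hy2 : y ≠ y2) (hyt : y ≠ tr) (h2t : y2 ≠ tr) {n : ℕ} (R : AStore Bool ι) (hy : R y = un n)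
    (hn : n ≤ (R tr).length) (hw : R w = []) : ∃ R' : AStore Bool ι,
      Runs (payLock y y2 tr flag w) R R' (8 * n + 6) ∧
      R' y = [] ∧ R' y2 = un n ++ R y2 ∧ R' tr = (R tr).drop n ∧ R' w = [] ∧
      ∀ r, r ≠ y → r ≠ y2 → r ≠ tr → r ≠ w → R' r = R r := by
  obtain ⟨R', hR', h1, h2, h3, h4, h5⟩ := runs_payLoop_ok hyw h2w htw hy2 hyt h2t n
    (update R w [true]) (by rw [update_of_ne hyw]; exact hy) (by rw [update_of_ne htw]; exact hn)
    (by simp)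
  refine ⟨R', ?_, h1, by rw [h2, update_of_ne h2w], by rw [h3, update_of_ne htw], h4,
    fun r g1 g2 g3 g4 => by rw [h5 r g1 g2 g3 g4, update_of_ne g4]⟩
  have h0 : Runs (push w true) R (update R w [true]) 1 := Runs.push' (by rw [hw])
  exact (h0.seq hR').mono (by omega)

/-- **`payLock`, payment short**: with `y = 1ⁿ`, `|tr| = m < n` and `w` empty: afterwards
`flag` carries one more token, `tr` is empty, `y = 1^{n-m-1}`, `y2 = 1^{m+1} ++ y2`, within
`8m + 10` steps — proportional to the payment consumed. [folklore] -/
theorem runs_payLock_short {y y2 tr flag w : ι} (hyw : y ≠ w) (h2w : y2 ≠ w) (htw : tr ≠ w)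
    (hfw : flag ≠ w) (hy2 : y ≠ y2) (hyt : y ≠ tr) (hyf : y ≠ flag) (h2t : y2 ≠ tr)
    (h2f : y2 ≠ flag) (htf : tr ≠ flag) {m n : ℕ} (R : AStore Bool ι) (hy : R y = un n)
    (hm : (R tr).length = m) (hmn : m < n) (hw : R w = []) : ∃ R' : AStore Bool ι,
      Runs (payLock y y2 tr flag w) R R' (8 * m + 10) ∧
      R' y = un (n - m - 1) ∧ R' y2 = un (m + 1) ++ R y2 ∧ R' tr = [] ∧ R' w = [] ∧
      R' flag = true :: R flag ∧
      ∀ r, r ≠ y → r ≠ y2 → r ≠ tr → r ≠ w → r ≠ flag → R' r = R r := by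
  obtain ⟨R', hR', h1, h2, h3, h4, h5, h6⟩ := runs_payLoop_short hyw h2w htw hfw hy2 hyt hyf h2t
    h2f htf m n (update R w [true]) (by rw [update_of_ne hyw]; exact hy)
    (by rw [update_of_ne htw]; exact hm) hmn (by simp)
  refine ⟨R', ?_, h1, by rw [h2, update_of_ne h2w], h3, h4, by rw [h5, update_of_ne hfw],
    fun r g1 g2 g3 g4 g5 => by rw [h6 r g1 g2 g3 g4 g5, update_of_ne g4]⟩
  have h0 : Runs (push w true) R (update R w [true]) 1 := Runs.push' (by rw [hw])
  exact (h0.seq hR').mono (by omega)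

/-! ### Comparing unary counters -/

/-- The body of `cmpUnary`: for each token of `a`, take a token of `b` (park it on `b2`), or
record a mismatch on `ne` if `b` is exhausted. [folklore] -/
def cmpBody (b b2 ne : ι) : ACom Bool ι :=
  pop b fun o => match o with
    | some _ => push b2 true
    | none => push ne true

/-- `cmpUnary a b b2 ne`: compare the unary counters `a` and `b`: `a` is consumed, the matched
tokens of `b` are parked on `b2` (the caller pours them back), and `ne` receives tokens iff the
counts differ (one per surplus token of `a`, or one if `b` is longer). [folklore] -/
def cmpUnary (a b b2 ne : ι) : ACom Bool ι :=
  (loop a fun _ => cmpBody b b2 ne) ;; pop b fun o => match o with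
    | some x => push b x ;; push ne true
    | none => skip

/-- The loop of `cmpUnary`. [folklore] -/
theorem runs_cmpLoop {a b b2 ne : ι} (hab : a ≠ b) (ha2 : a ≠ b2) (han : a ≠ ne) (hb2 : b ≠ b2)
    (hbn : b ≠ ne) (h2n : b2 ≠ ne) :
    ∀ (x y : ℕ) (R : AStore Bool ι), R a = un x → R b = un y → ∃ R' : AStore Bool ι,
      Runs (loop a fun _ => cmpBody b b2 ne) R R' (5 * x + 1) ∧
      R' a = [] ∧ R' b = un (y - x) ∧ R' b2 = un (min x y) ++ R b2 ∧ R' ne = un (x - y) ++ R ne ∧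
      ∀ r, r ≠ a → r ≠ b → r ≠ b2 → r ≠ ne → R' r = R r
  | 0, y, R, hx, hy => ⟨R, Runs.loop_nil _ (by simpa using hx), by simpa using hx,
      by simpa using hy, by simp, by simp, fun _ _ _ _ _ => rfl⟩
  | x + 1, 0, R, hx, hy => by
    set R₁ : AStore Bool ι := update (update R a (un x)) ne (true :: R ne) with hR₁
    have hbody : Runs (cmpBody b b2 ne) (update R a (un x)) R₁ (1 + 2) :=
      Runs.pop_nil (by rw [update_of_ne hab.symm]; simpa using hy) (Runs.push' (by
        rw [hR₁]; simp [update_of_ne han.symm]))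
    obtain ⟨R', hR', h1, h2, h3, h4, h5⟩ := runs_cmpLoop hab ha2 han hb2 hbn h2n x 0 R₁
      (by simp [hR₁, update_of_ne han]) (by simp [hR₁, update_of_ne hbn, update_of_ne hab.symm]; simpa using hy)
    refine ⟨R', (Runs.loop_cons (by simpa [un, List.replicate_succ] using hx) hbody hR').mono (by omega), h1,
      by simpa using h2, ?_, ?_, fun r g1 g2 g3 g4 => ?_⟩
    · rw [h3, hR₁]; simp [update_of_ne h2n, update_of_ne ha2.symm]
    · rw [h4, hR₁]; simp [un, List.replicate_succ']
    · rw [h5 r g1 g2 g3 g4, hR₁]; simp [update_of_ne g1, update_of_ne g4]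
  | x + 1, y + 1, R, hx, hy => by
    set R₁ : AStore Bool ι := update (update (update R a (un x)) b (un y)) b2 (true :: R b2) with hR₁
    have hbody : Runs (cmpBody b b2 ne) (update R a (un x)) R₁ (1 + 2) :=
      Runs.pop_cons (f := fun o => match o with
        | some _ => push b2 true
        | none => push ne true) (a := true) (w := un y)
        (by rw [update_of_ne hab.symm]; simpa [un, List.replicate_succ] using hy) (Runs.push' (by
          rw [hR₁]; simp [update_of_ne hb2.symm, update_of_ne ha2.symm]))
    obtain ⟨R', hR', h1, h2, h3, h4, h5⟩ := runs_cmpLoop hab ha2 han hb2 hbn h2n x y R₁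
      (by simp [hR₁, update_of_ne ha2, update_of_ne hab]) (by simp [hR₁, update_of_ne hb2])
    refine ⟨R', (Runs.loop_cons (by simpa [un, List.replicate_succ] using hx) hbody hR').mono (by omega), h1,
      ?_, ?_, ?_, fun r g1 g2 g3 g4 => ?_⟩
    · rw [h2]; congr 1; omega
    · rw [h3, hR₁]; simp [un, List.replicate_succ', Nat.succ_min_succ]
    · rw [h4, hR₁]; simp [update_of_ne h2n.symm, update_of_ne hbn.symm, update_of_ne han.symm]
    · rw [h5 r g1 g2 g3 g4, hR₁]; simp [update_of_ne g1, update_of_ne g2, update_of_ne g3]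

/-- **Effect and cost of `cmpUnary`** on `a = 1ˣ`, `b = 1ʸ`: `a` is emptied, `b = 1^{y-x}`,
`b2 = 1^{min x y} ++ b2`, and `ne` receives `x - y` tokens, plus one if `y > x` — so `ne` is
unchanged iff `x = y`; within `5x + 5` steps. [folklore] -/
theorem runs_cmpUnary {a b b2 ne : ι} (hab : a ≠ b) (ha2 : a ≠ b2) (han : a ≠ ne) (hb2 : b ≠ b2)
    (hbn : b ≠ ne) (h2n : b2 ≠ ne) {x y : ℕ} (R : AStore Bool ι) (hx : R a = un x)
    (hy : R b = un y) : ∃ R' : AStore Bool ι,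
      Runs (cmpUnary a b b2 ne) R R' (5 * x + 5) ∧
      R' a = [] ∧ R' b = un (y - x) ∧ R' b2 = un (min x y) ++ R b2 ∧
      R' ne = un (x - y + (if x < y then 1 else 0)) ++ R ne ∧
      ∀ r, r ≠ a → r ≠ b → r ≠ b2 → r ≠ ne → R' r = R r := by
  obtain ⟨R₁, hR₁, h1, h2, h3, h4, h5⟩ := runs_cmpLoop hab ha2 han hb2 hbn h2n x y R hx hy
  unfold cmpUnary
  by_cases hxy : x < y
  · -- `b` still holds a token: one more mismatch
    obtain ⟨d, hd⟩ : ∃ d, y - x = d + 1 := ⟨y - x - 1, by omega⟩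
    have htail : Runs (push b true ;; push ne true) (update R₁ b (un d))
        (update R₁ ne (true :: R₁ ne)) (1 + 1) := by
      refine (Runs.push b true _).seq (Runs.push' ?_)
      have eb : update (update R₁ b (un d)) b (true :: update R₁ b (un d) b) = R₁ := by
        rw [update_idem, update_self, show true :: un d = un (d + 1) from rfl, ← hd, ← h2, update_eq_self]
      rw [eb]
    refine ⟨update R₁ ne (true :: R₁ ne), (hR₁.seq (Runs.pop_cons (f := fun o => match o with
        | some x => push b x ;; push ne true
        | none => skip) (a := true) (w := un d) (by rw [h2, hd]; rfl) htail)).mono (by omega),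
        ?_, ?_, ?_, ?_, fun r g1 g2 g3 g4 => ?_⟩
    · simp [update_of_ne han, h1]
    · simp [update_of_ne hbn, h2]
    · simp [update_of_ne h2n, h3]
    · simp [h4, if_pos hxy, Nat.sub_eq_zero_of_le hxy.le, un]
    · simp [update_of_ne g4, h5 r g1 g2 g3 g4]
  · refine ⟨R₁, (hR₁.seq (Runs.pop_nil (by rw [h2]; simp [Nat.sub_eq_zero_of_le (Nat.le_of_not_lt hxy)])
      (Runs.skip _))).mono (by omega), h1, h2, h3, by simp [h4, if_neg hxy], h5⟩

end StackWhile

end Literature.Computability.Complexity
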